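import Mathlib
import HarnessLib
import HarnessLib.Audit
import Summits.QuantumFields.Statement
import HarnessLib.Audit.Status.Attr

/-!
Route: ComplexCouplingChannel

DORMANT since 2026-08-25T11:48:59Z (reconciler: no traction for 7.7 d (last activity item-evidence-added at 2026-08-17T19:14:14Z); parked, not closed — `ledger route dormant route-QuantumFields-ComplexCouplingChannel --off` to reactivat) — unstaffed, not closed; items shared with open routes are served there. `ledger route dormant <id> --off` reactivates.

# Route ComplexCouplingChannel — lattice gap by harmonic measure along a complex-coupling channel
from strong coupling (2001 x5 corridor)

It suffices to show X = TubeZeroFreeChannel ∧ FreeEnergyWindowChannel for every compact simple G and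
every faithful unitary lattice
representation r, together with the known-grade support ComplexStrongCouplingAnchor, the
provable-grade engine HarmonicMeasureEngine and the
shared existence leg ContinuumLegGivenGap (stmt-QuantumFields-15828). Objects: the Wilson partition
function of the periodic box L×L×L×t at
COMPLEX coupling z, Z_r(z; L, t) = ∫ exp(−z S_W) dHaar (entire in z), and a CHANNEL: an open
connected D ⊂ ℂ containing the target coupling β
and a real point inside any prescribed small disc around 0 (the strong-coupling anchor).
TubeZeroFreeChannel (rank 2): for every large β such a
channel exists on which, for every cross-section L ≥ L₀(β), the tube partition functions Z(z; L, t)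
have no zeros once t ≥ t₀(L) (length to
infinity FIRST: 2001 free seat x5's Hypothesis (Z)). FreeEnergyWindowChannel (rank 3): such a
channel exists on which the symmetric-torus
partition functions Z(z; P, P), P ≥ P₀(β), stay zero-free and within a bounded factor e^{±M} of
exp(−P⁴ f(z)) for ONE analytic f (the
continued bulk free energy): the finite-size free energy has a bounded continuation. RESURRECT-2001
of summits/ym/free/x5 ("the
complex-coupling corridor", parked 2026-08-09 for staffing, crux [A] open) re-typed into today's
Statement; realises the open hub cards
harmonic-measure-transmutation-ym (spine), zero-free-wilson-partition-function-gap and the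
structural card torus-clause-is-thermal-v2.
Lean: `TubeZeroFreeChannel ∧ FreeEnergyWindowChannel ∧ ComplexStrongCouplingAnchor ∧
HarmonicMeasureEngine ∧ ContinuumLegGivenGap`

## Assembly
Pure logic (theorem `closes` in Sketch.lean = glue.lean, sorry-free, axioms propext /
Classical.choice / Quot.sound): fix a compact simple G
with its Borel σ-algebra; ContinuumLegGivenGap reduces the G-clause of YangMills to the
UniformLatticeGap body for every faithful r, which
HarmonicMeasureEngine returns from the anchor and the two channel cruxes instantiated at (G, r).

Rationale: WHY THIS LINE. Mechanism (Penrose–Lebowitz transplanted to glue, PenroseLebowitz1974,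
LebowitzPenrose1968; 2001 x5 corridor.tex Thm 1.3, internal and
unrefereed): where the tube partition functions are zero-free for all large lengths, log of the top
transfer-matrix modulus is harmonic and
v_L(z) = log(second modulus / top modulus) is SUBHARMONIC (Vesentini), ≤ 0 trivially, and ≤ −c on
the strong-coupling disc uniformly in the
cross-section (OsterwalderSeilerAnnPhys1978, Seiler1982 at complex coupling); the two-constants
theorem then gives the transfer gap
m_L(β) ≥ c·ω_D(β) > 0 UNIFORMLY in L at every real β of the channel — the exponentially small
weak-coupling scale is manufactured by harmonic
measure, never estimated (with an axis-hugging channel of half-width δ the floor is e^{−πβ/2δ}, and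
asymptotic freedom is the equality case,
forcing δ ≤ 11N²/(24π): tHooft1979Erice's strip; doi:10.1103/physrevlett.104.251601 for the
SU(2)/U(1) Fisher-zero numerics). NEW here: the
same engine applied to the holomorphic function Z(z;P,P)·e^{P⁴f(z)} − 1 (bounded on the channel by
FreeEnergyWindowChannel, exponentially small
on the disc by the anchor) makes the symmetric-torus finite-size free energy log Z + P⁴f, which
reflection positivity shows is the SUM of the
non-negative thermal trace and the non-negative Casimir deficit (Luscher1977; 2001 pingap theory
tgap3 (FE⁰); card torus-clause-is-thermal-v2),
exponentially small — so harmonic measure also pays the torus clause of `HasLatticeMassGap` that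
every spectral route owes, and the engine lands
exactly the UniformLatticeGap body consumed by the shared leg. Imported area: potential theory / one
complex variable (subharmonic functions,
harmonic measure via three-circles chains, Beraha–Kahane–Weiss equimodularity BerahaKahaneWeiss1975,
SalasSokal2001) on top of RP transfer-matrix
spectral theory. What it does that listed routes do not: no route uses complex coupling; the
nearest, GronwallGap, continues the
strong-coupling gap along REAL analytic action paths by an a-priori log-Lipschitz modulus of the gap
(an ODE) — here the gap is neither
differentiated nor bounded along the way, the hypotheses are zero-location / free-energy statements,
and U(1)₄ is excluded at the right place
(its zeros pinch the axis at β_c ≈ 1.01, x5 Thm 7.1 / Guth1980, FrohlichSpencerCMP1982, so no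
anchor-connected channel exists).

RANKED CRUXES. #2 TubeZeroFreeChannel (crux) — for every compact simple G and faithful unitary r
there is β₁ such that for every β ≥ β₁ and every ρ > 0 there is an open connected D ⊂ ℂ with β ∈ D
and some real x ∈ D, |x| < ρ, and a cross-section floor L₀ such that for every L ≥ L₀ the
complex-coupling Wilson partition functions of the boxes L³×t have no zeros on D for all t ≥ t₀(L)
(2001 x5 Hypothesis (Z) on an anchor-connected channel; card zero-free-wilson-partition-function-gap
P2 in tube form). [difficulty: open-problem] (why it might fail: A bulk transition whose complex
coexistence locus disconnects strong from weak coupling for some (G, r) (no complex critical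
endpoint: SU(N≥4) fundamental, SO(3), G₂ are first order on the axis), or a volume-stable level
equimodular with the vacuum arbitrarily near the axis at L ≫ ξ.) [PenroseLebowitz1974,
doi:10.1103/physrevlett.104.251601, BerahaKahaneWeiss1975, SalasSokal2001,
OsterwalderSeilerAnnPhys1978, LuciniTeperWenger2004, BhanotCreutz1981, tHooft1979Erice]
#3 FreeEnergyWindowChannel (crux) — for every compact simple G and faithful unitary r there is β₁
such that for every β ≥ β₁ and ρ > 0 there is an open connected D with β ∈ D and a real x ∈ D, |x| <
ρ, an analytic f on D, a constant M and P₀ such that for all P ≥ P₀ and z ∈ D: Z(z;P,P) ≠ 0 and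
|log|Z(z;P,P)| + P⁴ Re f(z)| ≤ M (bounded continuation of the symmetric-torus finite-size free
energy; pays the thermal/Casimir clause by harmonic measure). [difficulty: open-problem] (why it
might fail: A second branch (complex plasma/torelon phase, Re a(z)⁴ < 0 beyond |Im z| ≈ 11N²/(96π))
pinching to the axis near the crossover, marching finite-size zeros inside every admissible D, or
finite-size corrections growing with P (CFT-like plateau is fine, growth is not).) [Luscher1977,
Luscher1986, Michael1987, PrivmanFisher1983, doi:10.1103/physrevlett.104.251601,
doi:10.17077/etd.bfnqfycu, LeeYang1952]
#4 ContinuumLegGivenGap (crux) — (SHARED VERBATIM, stmt-QuantumFields-15828, the existence leg) for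
every compact simple G: the volume-uniform weak-coupling lattice gap for every faithful r implies
the G-clause of YangMills along a weak-coupling scheme (β_k → ∞, a_k ∝ m(β_k)). [difficulty:
open-problem] (why it might fail: Existence half of the problem: E0–E4 + IsYangMillsFor for ALL
species lie beyond Bałaban's UV stability; if ξ(β) stayed bounded every weak-coupling limit would be
ultralocal ⇒ Gaussian, IsNonGaussian fails.) [JaffeWitten2000, Balaban1989LargeFieldII,
ChatterjeeYMProb2019]
#9 ComplexStrongCouplingAnchor (support) — (known-grade: Osterwalder–Seiler / Seiler polymer
expansion at COMPLEX coupling with wrapping corrections) there are ρ₀, c > 0 such that for |z| < ρ₀: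
every tube L³×t is zero-free with Z(z;L,t)·e^(−t e_L(z)) = 1 + O_L(e^(−ct)) for some tube rate e_L
(exponential pinning ⇒ v_L ≤ −c uniformly in L), and the symmetric tori satisfy |log|Z(z;P,P)| + P⁴
Re f(z)| ≤ C P⁴ e^(−cP) for one analytic f on the disc. [difficulty: L]
[OsterwalderSeilerAnnPhys1978, Seiler1982, KoteckyPreiss1986]
#9 HarmonicMeasureEngine (support) — anchor ∧ TubeZeroFreeChannel ∧ FreeEnergyWindowChannel ⇒ for
every compact simple G and faithful r the UniformLatticeGap body (∃β₀ ∀β≥β₀ ∃m>0 ∃S₁ ∀A,B ∃C ∀S≥S₁,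
n≤S: |latticeConnectedCorr r.ρ β (2S+1) A B n| ≤ Ce^(−mn)). Intended proof (2001 x5 Thm 1.3 + new
thermal leg): Lüscher/OS transfer matrix of Wilson's measure on L³ cross-sections, Jentzsch at real
β, harmonicity of log of the top modulus from tube zero-freeness (crease lemma, BKW), Vesentini
subharmonicity of the second modulus, two-constants via chains of Hadamard three-circles (Mathlib
three-lines ∘ exp) ⇒ m_L(β) ≥ cω(β) for L ≥ L₀; two-constants for Z e^(P⁴(f−ic)) − 1 ⇒ 0 ≤ log
Z_(P⁴)(β) + P⁴f(β) ≤ ε_P = O(e^(−cωP)) ⇒ thermal trace θ_P ≤ e^(ε_P) − 1; spectral bookkeeping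
corr(n) = O(e^(−mn)) + O(θ_P) on the torus of side P = 2S+1. [difficulty: XL] [PenroseLebowitz1974,
Luscher1977, OsterwalderSeilerAnnPhys1978, Seiler1982, BerahaKahaneWeiss1975, Kato1966]

TWO-LAYER PLAN. Foreseen glued splits (nothing filed now; both glues are PROVED in bc/*_birth.lean):
TubeZeroFreeChannel ⇐ CrossoverBridge (the anchor-connected
zero-free component reaches arbitrarily large couplings at SOME points; U(1)₄-false, finite coupling
range, "certifiable once") → WeakCouplingCorridor
(beyond some β_c any two axis points are joined by a zero-free channel; the asymptotic-freedom
piece, U(1)-true in kind) → TubeZeroFreeChannel (union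
of channels sharing a real point). FreeEnergyWindowChannel ⇐ TorusZeroFreeChannel (Fisher zeros of
symmetric tori off the channel) →
BoundedCorrectionGivenZeroFree (Vitali/Harnack continuation of f + bounded finite-size correction) →
FreeEnergyWindowChannel.

KILL CRITERIA. TubeZeroFreeChannel refuted for some (G, r) by a DISCONNECTING zero locus (no channel
from the disc to large β: proved pinch without complex
endpoint) ⇒ close refuted:TubeZeroFreeChannel and file the witness as a barrier (bulk coexistence
loci of Wilson actions). Refuted only in the
axis-hugging form (zeros at height → 0 near the crossover but a detour exists) ⇒ no pivot needed (D
is existential). FreeEnergyWindowChannel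
refuted by unbounded finite-size corrections on every admissible channel ⇒ pivot ONCE to the
tube-state formulation of x5 Thm 1.3(ii)
(infinite-volume clustering + a separate vacuum-dominance item) or close. HarmonicMeasureEngine
refuted ⇒ a typing/convention error (inline Z
vs the tree's wilsonMeasure, multi-slice observables): restate, not a kill. Mooted if
UniformLatticeGap (stmt-QuantumFields-8778) or
GronwallGap.LatticeGapOffTransitions is proved by another route.

NOT DECOMPOSED YET. The transfer matrix of the tree's torus Wilson measure (Lüscher's construction
is not a tree object), Jentzsch/Perron–Frobenius and the
crease lemma, the three-circles chain (harmonic measure is not in Mathlib; chains of Hadamard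
three-lines∘exp replace it), the thermal
bookkeeping for multi-slice cylinder observables, and every constant (ρ₀, c, widths, L₀(β) ≫ ξ(β) to
pass the intermediate-volume regime where
near-degenerate electric-flux levels DO pull tube zeros to the axis) are layer-2 children of the
engine; the corridor-width/extremality lemma
(axis-hugging half-width δ + AF upper bound on the gap ⇒ δ ≤ π/(2c₁)) is a non-load-bearing rider,
deliberately not an item.

CHEAPEST FALSIFIER. (i) Tube Fisher zeros by exact transfer-matrix/character expansion or
reweighting Monte Carlo ⟨e^(−iyS)⟩_β for SU(2), β ∈ [1.8, 2.8], boxes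
L³×t with L = 4, 6, 8 and t = 2L…4L, plus symmetric 4⁴, 6⁴, 8⁴: zeros marching TOWARD the real axis
with L at fixed Re z below the crossover
kill TubeZeroFreeChannel for SU(2) (and confinement folklore with it); stabilisation at |Im β| ≈
0.15 near Re β ≈ 2.2–2.3 (the published 4⁴/6⁴
density-of-states result, doi:10.1103/physrevlett.104.251601) with a clean hugging channel below is
the predicted outcome; run U(1) as control
(the pinch at β_c ≈ 1.01 must appear). One kit job for a refuter (hub is compute-free; not run
here). (ii) In Lean, done: z = 0 gives Z ≡ 1
for every box (bc/special.lean, rc 0, no sorry) — the anchor centre is exactly zero-free with zero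
finite-size correction. (iii) Lookup done: no
non-abelian Lee–Yang/contraction theorem for plaquette weights exists (TY85 p. 313; cards' and x5's
searches; mine below) — the crux is open, not known.

NUMBERS. Strip numerology (heuristic, x5 §6 and card): one-loop a(z) ∝ e^(−κz), κ = 12π²/(11N²) in β
= 2N/g₀² units; vacuum–glueball equimodularity at
|Im z| = π/(2κ) = 11N²/(24π) = 0.584 (SU(2)), 1.313 (SU(3)); torelon (energy ∝ a²L) at half that,
0.292 / 0.657; extensive scaling levels
(energy ∝ a⁴L³) at a quarter, 0.146 / 0.328 — the predicted asymptotic half-width of an axis-hugging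
channel for periodic boxes; observed SU(2)
zeros on 4⁴–6⁴ stabilise at |Im β| ≈ 0.15–0.2 near Re β ≈ 2.2–2.3
(doi:10.1103/physrevlett.104.251601); U(1)₄ zeros pinch at β_c = 1.0113(2)
(doi:10.17077/etd.bfnqfycu). RP facts used by the engine: Tr T^(2t) ≤ (Tr T^t)² and Casimir deficit
≤ 0 ⇒ log Z(P⁴) + P⁴f = thermal + Casimir,
both ≥ 0 (Luscher1977). Strong-coupling radius: Osterwalder–Seiler polymer expansion converges for
|β| < β₀(G, r, 4) (OsterwalderSeilerAnnPhys1978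
Thm 3.5 / Seiler1982 Ch. 3). Harmonic-measure floor in a hugging channel of half-width δ: m(β) ≥
c·e^(−π(β−β₀)/2δ) (card engine E; x5 Cor 6.2).
Items at open: 6.

DEFINITION REQUESTS. None blocking (the complex box partition function is inlined over Measure.pi /
haarProbability / LatticeRep; the UniformLatticeGap body uses the
tree's latticeConnectedCorr). Wanted later for the engine's provers, as Literature definitions: the
positive transfer matrix of `wilsonMeasure` on
boxes (notion transfer_matrix, recorded absent in ConstructiveQFTWave0) and a
`boxWilsonPartitionFunction` at complex coupling; to be filed with
`ledger workitem add --kind definition` after open if the engine is claimed.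

Novelty: Searches (2026-08-17): `lit search --source crossref "Penrose Lebowitz exponential decay of
correlation functions"` (10: PenroseLebowitz1974,
LebowitzPenrose1968, nothing gauge); `… "Fisher zeros SU(2) lattice gauge theory complex coupling"`
(12: Du thesis doi:10.17077/etd.bfnqfycu,
Meurice PoS 2011/2012, Tomboulis 1982 PLB — numerics/heuristics only); `… "partition function zeros
transfer matrix eigenvalue crossing Beraha
Kahane Weiss"` (10: BKW 1975/1980, SalasSokal2001 — spin/graph polynomials); `… "absence of zeros
implies strong spatial mixing"` (Regts PTRF 2023
doi:10.1007/s00440-023-01190-z, MartinelliOlivieriSchonmann 1994 — spins); `… "lattice gauge theory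
finite size effects torus free energy glueball
gas torelon"` (8: Michael1987, DeGrand–Peterson 1986 — numerics); `lit galaxy search "Fisher zeros"
--star all` (22 rows, none on a zeros ⇒ gap
theorem for gauge theories); `lit galaxy search "complex coupling" --star pdf` (noise); local
searchd unavailable (connection reset, recorded);
`ledger negatives --problem QuantumFields` (5, none related); bc/dedup.lean `exact?` over Mathlib +
4 Literature modules + 26 YangMills Theses
(no hit); hub cards read in full: harmonic-measure-transmutation-ym (open, refuter grade variant),
zero-free-wilson-partition-function-gap
(open, variant), _closed/flare-not-strip-box-not-torus (merged, variant), torus-clause-is-thermal-v2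
(open, variant); 2001 archive:
summits/ym/free/x5 LINE.md, CLAIMS.md, corridor.tex §§1–5 (Thm 1.3, Hyp 1.2,  [refs: 10.17077/etd.bfnqfycu, 10.1007/s00440-023-01190-z, 10.1103/physrevlett.104.251601, doi:10.17077/etd.bfnqfycu, doi:10.1007/s00440-023-01190-z, doi:10.1103/physrevlett.104.251601, PenroseLebowitz1974, LebowitzPenrose1968, SalasSokal2001, Michael1987]

Barriers (technique_class: complex-beta-continuation, zero-freeness, harmonic-measure): - technique_class: complex-beta-continuation, zero-freeness, harmonic-measure
- Literature.Barriers.QuantumFields.PerturbativeInvisibility: evaded — nothing is expanded in g; the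
weak-coupling smallness of the gap is the harmonic measure of the anchor seen through the channel,
and the hypotheses are qualitative (zero location, boundedness).
- Literature.Barriers.QuantumFields.AbelianDeconfinementD4: evaded at the right item — for U(1)₄ the
tube zeros accumulate at a real β* ≤ β_FS (x5 Thm 7.1 from Guth1980 / FrohlichSpencerCMP1982 +
Ginibre), so no anchor-connected channel exists and TubeZeroFreeChannel is U(1)-false, while the
engine and the weak-coupling corridor piece are group-blind and harmless; any proof of the bridge
must use the non-abelian group.
- Literature.Barriers.QuantumFields.MigdalKadanoffGroupBlindness: nothing is decimated; Meurice's
"zeros = gates of complexified MK flows" is cited as numerics only, and the U(1) control is part of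
the falsifier protocol (ItoSeiler2007Tomboulis is the recorded failure of the decimation road).
- Literature.Barriers.QuantumFields.ZnHiggsPhaseD4: (file DiscreteSubgroupFreezing) finite subgroups
have freezing/Higgs transitions whose zeros pinch the axis — the crux is stated for compact simple
(connected, non-abelian) G only and is false for ℤ_N approximants, consistently.
- Literature.Barriers.QuantumFields.FiniteTemperatureDeconfinement: tubes L³×t with t → ∞ FIRST and
symmetric tori only; thin slabs ℤ³×ℤ_(N_t), where deconfine

History (route lifecycle, newest last):
- 2026-08-25T11:48:59Z · DORMANT — reconciler: no traction for 7.7 d (last activity item-evidence-added at 2026-08-17T19:14:14Z); parked, not closed — `ledger route dormant route-QuantumFields-Co (operator:999:1318078)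

sub-problem: YangMills · status: dormant · opened planner-plan-lens3-QuantumFields-resurrect-g2-0 2026-08-17T03:03:24Z · rev 1 · ledger route-QuantumFields-ComplexCouplingChannel
GENERATED by the gate from the ledger (D-0016/17). Provers cite these decls: `theorem foo : Summit.QuantumFields.YangMills.Theses.ComplexCouplingChannel.<Decl> := …` in Summits/QuantumFields/YangMills/Theorems/<Name>.lean.
-/

namespace Summit.QuantumFields.YangMills.Theses.ComplexCouplingChannel

open scoped BigOperators Topology Manifold Classical MeasureTheory ProbabilityTheory Matrix InnerProductSpace ComplexConjugate ContinuousMap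
open Filter Set Function TopologicalSpace MeasureTheory

attribute [summit_statement] _root_.YangMills

/-- item stmt-QuantumFields-18841 · crux · rank 2 · open · by planner
why it might fail: A bulk transition whose complex coexistence locus disconnects strong from weak coupling for some (G, r) (no complex critical endpoint: SU(N≥4) fundamental, SO(3), G₂ are first order on the axis), or a volume-stable level equimodular with the vacuum arbitrarily near the axis at L ≫ ξ.
sources: PenroseLebowitz1974, doi:10.1103/physrevlett.104.251601, BerahaKahaneWeiss1975, SalasSokal2001, OsterwalderSeilerAnnPhys1978, LuciniTeperWenger2004
[crux] for every compact simple G and faithful unitary r there is β₁ such that for every β ≥ β₁ and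
every ρ > 0 there is an open connected D ⊂ ℂ with β ∈ D and some real x ∈ D, |x| < ρ, and a
cross-section floor L₀ such that for every L ≥ L₀ the complex-coupling Wilson partition functions of
the boxes L³×t have no zeros on D for all t ≥ t₀(L) (2001 x5 Hypothesis (Z) on an anchor-connected
channel; card zero-free-wilson-partition-function-gap P2 in tube form). [difficulty: open-problem] -/
@[route_item "route-QuantumFields-ComplexCouplingChannel", crux]
def TubeZeroFreeChannel : Prop :=
  ∀ (G : Type) [Group G] [TopologicalSpace G] [IsTopologicalGroup G] [CompactSpace G] [MeasurableSpace G] [BorelSpace G], Literature.MathematicalPhysics.QuantumFieldTheory.IsCompactSimpleLieGroup G → ∀ r : Literature.MathematicalPhysics.QuantumFieldTheory.LatticeRep G, let Zc : ℂ → ℕ → ℕ → ℂ := fun z a t => let St := Fin a × Fin a × Fin a × Fin t; let sh : St → Fin 4 → St := fun x μ => ![(finRotate a x.1, x.2.1, x.2.2.1, x.2.2.2), (x.1, finRotate a x.2.1, x.2.2.1, x.2.2.2), (x.1, x.2.1, finRotate a x.2.2.1, x.2.2.2), (x.1, x.2.1, x.2.2.1, finRotate t x.2.2.2)] μ; let pl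 : (St × Fin 4 → G) → St → Fin 4 → Fin 4 → G := fun U x μ ν => U (x, μ) * U (sh x μ, ν) * (U (sh x ν, μ))⁻¹ * (U (x, ν))⁻¹; ∫ U, Complex.exp (-(z * ((∑ x : St, ∑ q : {q : Fin 4 × Fin 4 // q.1 < q.2}, ((r.N : ℝ) - (r.ρ (pl U x q.1.1 q.1.2)).trace.re) : ℝ) : ℂ))) ∂(Measure.pi fun _ : St × Fin 4 => Literature.MathematicalPhysics.QuantumFieldTheory.haarProbability G); ∃ β₁ : ℝ, ∀ β : ℝ, β₁ ≤ β → ∀ ρ : ℝ, 0 < ρ → ∃ D : Set ℂ, IsOpen D ∧ IsConnected D ∧ (β : ℂ) ∈ D ∧ (∃ x : ℝ, |x| < ρ ∧ (x : ℂ) ∈ D) ∧ ∃ L₀ : ℕ, ∀ L : ℕ, L₀ ≤ L → ∃ t₀ : ℕ, ∀ t : ℕ, t₀ ≤ t → ∀ z ∈ D, Zc z L t ≠ 0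

/-- item stmt-QuantumFields-18842 · crux · rank 3 · open · by planner
why it might fail: A second branch (complex plasma/torelon phase, Re a(z)⁴ < 0 beyond |Im z| ≈ 11N²/(96π)) pinching to the axis near the crossover, marching finite-size zeros inside every admissible D, or finite-size corrections growing with P (CFT-like plateau is fine, growth is not).
sources: Luscher1977, Luscher1986, Michael1987, PrivmanFisher1983, doi:10.1103/physrevlett.104.251601, doi:10.17077/etd.bfnqfycu
[crux] for every compact simple G and faithful unitary r there is β₁ such that for every β ≥ β₁ and
ρ > 0 there is an open connected D with β ∈ D and a real x ∈ D, |x| < ρ, an analytic f on D, a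
constant M and P₀ such that for all P ≥ P₀ and z ∈ D: Z(z;P,P) ≠ 0 and |log|Z(z;P,P)| + P⁴ Re f(z)|
≤ M (bounded continuation of the symmetric-torus finite-size free energy; pays the thermal/Casimir
clause by harmonic measure). [difficulty: open-problem] -/
@[route_item "route-QuantumFields-ComplexCouplingChannel", crux]
def FreeEnergyWindowChannel : Prop :=
  ∀ (G : Type) [Group G] [TopologicalSpace G] [IsTopologicalGroup G] [CompactSpace G] [MeasurableSpace G] [BorelSpace G], Literature.MathematicalPhysics.QuantumFieldTheory.IsCompactSimpleLieGroup G → ∀ r : Literature.MathematicalPhysics.QuantumFieldTheory.LatticeRep G, let Zc : ℂ → ℕ → ℕ → ℂ := fun z a t => let St := Fin a × Fin a × Fin a × Fin t; let sh : St → Fin 4 → St := fun x μ => ![(finRotate a x.1, x.2.1, x.2.2.1, x.2.2.2), (x.1, finRotate a x.2.1, x.2.2.1, x.2.2.2), (x.1, x.2.1, finRotate a x.2.2.1, x.2.2.2), (x.1, x.2.1, x.2.2.1, finRotate t x.2.2.2)] μ; let pl : (St × Fin 4 → G) → St → Fin 4 → Fin 4 → G := fun U x μ ν => U (x, μ) *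 U (sh x μ, ν) * (U (sh x ν, μ))⁻¹ * (U (x, ν))⁻¹; ∫ U, Complex.exp (-(z * ((∑ x : St, ∑ q : {q : Fin 4 × Fin 4 // q.1 < q.2}, ((r.N : ℝ) - (r.ρ (pl U x q.1.1 q.1.2)).trace.re) : ℝ) : ℂ))) ∂(Measure.pi fun _ : St × Fin 4 => Literature.MathematicalPhysics.QuantumFieldTheory.haarProbability G); ∃ β₁ : ℝ, ∀ β : ℝ, β₁ ≤ β → ∀ ρ : ℝ, 0 < ρ → ∃ D : Set ℂ, IsOpen D ∧ IsConnected D ∧ (β : ℂ) ∈ D ∧ (∃ x : ℝ, |x| < ρ ∧ (x : ℂ) ∈ D) ∧ ∃ f : ℂ → ℂ, DifferentiableOn ℂ f D ∧ ∃ M : ℝ, ∃ P₀ : ℕ, ∀ P : ℕ, P₀ ≤ P → ∀ z ∈ D, Zc z P P ≠ 0 ∧ |Real.log ‖Zc z P P‖ + (P : ℝ) ^ 4 * (f z).re| ≤ M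

/-- item stmt-QuantumFields-15828 · crux · rank 4 · open · by operator
why it might fail: Existence half of the problem: E0–E4 + IsYangMillsFor for ALL species lie beyond Bałaban's UV stability; if ξ(β) stayed bounded every weak-coupling limit would be ultralocal ⇒ Gaussian, IsNonGaussian fails.
sources: JaffeWitten2000, Balaban1989LargeFieldII, ChatterjeeYMProb2019
[crux] (existence leg, RE-TYPED for the 2026-08-16 Statement) for every compact simple Lie group G:
IF for every faithful unitary r the volume-uniform weak-coupling lattice gap holds
(UniformLatticeGap body for G, Borel σ-algebra), THEN there are r, a sequential scheme sch WITH β_k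
→ ∞ (`sch.HasWeakCouplingLimit`) and OS data T with IsYangMillsFor r sch T, T non-trivial and
non-Gaussian in tr F², and Δ > 0 with T.HasMassGap Δ ∧ HasLatticeMassGap r sch Δ. Intended use: a_k
∝ m(β_k) with β_k → ∞ (ξ(β) → ∞ is 2001-refereed and hub-filed: DirichletWindow /
XiCompleteMonotonicity), joint continuum limit with E0–E4 at that scale (Bałaban UV control, E1 by
any of the hub's rotation routes), non-triviality from the curvature three/four-point function.
[deps: UniformLatticeGap] [difficulty: open-problem] -/
@[route_item "route-QuantumFields-ComplexCouplingChannel", crux]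
def ContinuumLegGivenGap : Prop :=
  ∀ (G : Type) [Group G] [TopologicalSpace G] [IsTopologicalGroup G] [CompactSpace G], Literature.MathematicalPhysics.QuantumFieldTheory.IsCompactSimpleLieGroup G → letI : MeasurableSpace G := borel G; haveI : BorelSpace G := ⟨rfl⟩; (∀ r : Literature.MathematicalPhysics.QuantumFieldTheory.LatticeRep G, ∃ β₀ : ℝ, ∀ β : ℝ, β₀ ≤ β → ∃ m : ℝ, 0 < m ∧ ∃ S₁ : ℕ, ∀ A B : Literature.MathematicalPhysics.QuantumFieldTheory.YMSpecies G, ∃ C : ℝ, ∀ S n : ℕ, S₁ ≤ S → n ≤ S → |Literature.MathematicalPhysics.QuantumFieldTheory.latticeConnectedCorr r.ρ β (2 * S + 1) A.F B.F n| ≤ C * Real.exp (-(m * n))) → ∃ (r : Literature.MathematicalPhysics.QuantumFieldTheory.LatticeRep G) (sch : Literature.MathematicalPhysics.QuantumFieldTheory.SpeciesScheme (Literature.MathematicalPhysics.QuantumFieldTheory.YMSpecies G)) (T : Literature.MathematicalPhysics.QuantumFieldTheory.OSData (Literature.MathematicalPhysics.QuantumFieldTheory.YMSpecies G) 4), sch.HasWeakCouplingLimit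 ∧ Literature.MathematicalPhysics.QuantumFieldTheory.IsYangMillsFor r sch T ∧ T.IsNontrivial r.curvature ∧ T.IsNonGaussian r.curvature ∧ ∃ Δ > 0, T.HasMassGap Δ ∧ Literature.MathematicalPhysics.QuantumFieldTheory.HasLatticeMassGap r sch Δ

/-- item stmt-QuantumFields-18843 · support · rank 9 · closed · proved by Summit.QuantumFields.YangMills.Theorems.complexStrongCouplingAnchor_proof @ 85175bdfba08 (prover) · by planner
sources: OsterwalderSeilerAnnPhys1978, Seiler1982, KoteckyPreiss1986
[support] (known-grade: Osterwalder–Seiler / Seiler polymer expansion at COMPLEX coupling with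
wrapping corrections) there are ρ₀, c > 0 such that for |z| < ρ₀: every tube L³×t is zero-free with
Z(z;L,t)·e^(−t e_L(z)) = 1 + O_L(e^(−ct)) for some tube rate e_L (exponential pinning ⇒ v_L ≤ −c
uniformly in L), and the symmetric tori satisfy |log|Z(z;P,P)| + P⁴ Re f(z)| ≤ C P⁴ e^(−cP) for one
analytic f on the disc. [difficulty: L] -/
@[route_item "route-QuantumFields-ComplexCouplingChannel", crux]
def ComplexStrongCouplingAnchor : Prop :=
  ∀ (G : Type) [Group G] [TopologicalSpace G] [IsTopologicalGroup G] [CompactSpace G] [MeasurableSpace G] [BorelSpace G], Literature.MathematicalPhysics.QuantumFieldTheory.IsCompactSimpleLieGroup G → ∀ r : Literature.MathematicalPhysics.QuantumFieldTheory.LatticeRep G, let Zc : ℂ → ℕ → ℕ → ℂ := fun z a t => let St := Fin a × Fin a × Fin a × Fin t; let sh : St → Fin 4 → St := fun x μ => ![(finRotate a x.1, x.2.1, x.2.2.1, x.2.2.2), (x.1, finRotate a x.2.1, x.2.2.1, x.2.2.2), (x.1, x.2.1, finRotate a x.2.2.1, x.2.2.2), (x.1, x.2.1, x.2.2.1, finRotate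 t x.2.2.2)] μ; let pl : (St × Fin 4 → G) → St → Fin 4 → Fin 4 → G := fun U x μ ν => U (x, μ) * U (sh x μ, ν) * (U (sh x ν, μ))⁻¹ * (U (x, ν))⁻¹; ∫ U, Complex.exp (-(z * ((∑ x : St, ∑ q : {q : Fin 4 × Fin 4 // q.1 < q.2}, ((r.N : ℝ) - (r.ρ (pl U x q.1.1 q.1.2)).trace.re) : ℝ) : ℂ))) ∂(Measure.pi fun _ : St × Fin 4 => Literature.MathematicalPhysics.QuantumFieldTheory.haarProbability G); ∃ ρ₀ : ℝ, 0 < ρ₀ ∧ ∃ c : ℝ, 0 < c ∧ (∀ L : ℕ, 1 ≤ L → ∃ C : ℝ, ∃ e : ℂ → ℂ, ∀ t : ℕ, 1 ≤ t → ∀ z : ℂ, ‖z‖ < ρ₀ → Zc z L t ≠ 0 ∧ ‖Zc z L t * Complex.exp (-(t * e z)) - 1‖ ≤ C * Real.exp (-(c * t))) ∧ ∃ f : ℂ → ℂ, DifferentiableOn ℂ f (Metric.ball 0 ρ₀) ∧ ∃ C : ℝ, ∀ P : ℕ, 1 ≤ P → ∀ z : ℂ, ‖z‖ < ρ₀ →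 Zc z P P ≠ 0 ∧ |Real.log ‖Zc z P P‖ + (P : ℝ) ^ 4 * (f z).re| ≤ C * (P : ℝ) ^ 4 * Real.exp (-(c * P))

/-- item stmt-QuantumFields-18844 · support · rank 9 · open · by planner
sources: PenroseLebowitz1974, Luscher1977, OsterwalderSeilerAnnPhys1978, Seiler1982, BerahaKahaneWeiss1975, Kato1966
[support] anchor ∧ TubeZeroFreeChannel ∧ FreeEnergyWindowChannel ⇒ for every compact simple G and
faithful r the UniformLatticeGap body (∃β₀ ∀β≥β₀ ∃m>0 ∃S₁ ∀A,B ∃C ∀S≥S₁, n≤S: |latticeConnectedCorr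
r.ρ β (2S+1) A B n| ≤ Ce^(−mn)). Intended proof (2001 x5 Thm 1.3 + new thermal leg): Lüscher/OS
transfer matrix of Wilson's measure on L³ cross-sections, Jentzsch at real β, harmonicity of log of
the top modulus from tube zero-freeness (crease lemma, BKW), Vesentini subharmonicity of the second
modulus, two-constants via chains of Hadamard three-circles (Mathlib three-lines ∘ exp) ⇒ m_L(β) ≥
cω(β) for L ≥ L₀; two-constants for Z e^(P⁴(f−ic)) − 1 ⇒ 0 ≤ log Z_(P⁴)(β) + P⁴f(β) ≤ ε_P =
O(e^(−cωP)) ⇒ thermal trace θ_P ≤ e^(ε_P) − 1; spectral bookkeeping corr(n) = O(e^(−mn)) + O(θ_P) on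
the torus of side P = 2S+1. [difficulty: XL] -/
@[route_item "route-QuantumFields-ComplexCouplingChannel", crux]
def HarmonicMeasureEngine : Prop :=
  ComplexStrongCouplingAnchor → TubeZeroFreeChannel → FreeEnergyWindowChannel → (∀ (G : Type) [Group G] [TopologicalSpace G] [IsTopologicalGroup G] [CompactSpace G] [MeasurableSpace G] [BorelSpace G], Literature.MathematicalPhysics.QuantumFieldTheory.IsCompactSimpleLieGroup G → ∀ r : Literature.MathematicalPhysics.QuantumFieldTheory.LatticeRep G, ∃ β₀ : ℝ, ∀ β : ℝ, β₀ ≤ β → ∃ m : ℝ, 0 < m ∧ ∃ S₁ : ℕ, ∀ A B : Literature.MathematicalPhysics.QuantumFieldTheory.YMSpecies G, ∃ C : ℝ, ∀ S n : ℕ, S₁ ≤ S → n ≤ S → |Literature.MathematicalPhysics.QuantumFieldTheory.latticeConnectedCorr r.ρ β (2 * S + 1) A.F B.F n| ≤ C * Real.exp (-(m * n)))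

/-- item stmt-QuantumFields-18845 · assembly · rank 1 · closed · proved by Summit.QuantumFields.YangMills.Theorems.complexCouplingChannel_assembly_proof @ 97ed2f2c136b (prover) · by planner
sources: JaffeWitten2000, PenroseLebowitz1974
[assembly] TubeZeroFreeChannel → FreeEnergyWindowChannel → ComplexStrongCouplingAnchor →
HarmonicMeasureEngine → ContinuumLegGivenGap → YangMills. -/
@[route_item "route-QuantumFields-ComplexCouplingChannel"]
def Assembly : Prop :=
  TubeZeroFreeChannel → FreeEnergyWindowChannel → ComplexStrongCouplingAnchor → HarmonicMeasureEngine → ContinuumLegGivenGap → YangMills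

/-! D-0027 §2.1 — DECIDING THEOREM (planner-authored via `route open/edit --closes-file`; by planner-plan-lens3-QuantumFields-resurrect-g2-0 2026-08-17T03:03:24Z):
its hypotheses are this route's items and its conclusion the sub-problem Statement (glue_lint), and it elaborates with this file. -/

/-- DECIDING THEOREM (D-0027 §2.1), pure logic: fix a compact simple `G` with its Borel σ-algebra;
`ContinuumLegGivenGap` (the shared existence leg, weak-coupling scheme `β_k → ∞`) reduces `YangMills` for
`G` to the volume-uniform weak-coupling lattice gap for every faithful unitary `r`, which the support
`HarmonicMeasureEngine`, fed with the support `ComplexStrongCouplingAnchor` and the two channel cruxes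
`TubeZeroFreeChannel`, `FreeEnergyWindowChannel`, returns at `(G, r)`.
Axioms: propext, Classical.choice, Quot.sound. -/
@[closes "route-QuantumFields-ComplexCouplingChannel"] theorem closes (hT : TubeZeroFreeChannel) (hF : FreeEnergyWindowChannel) (hA : ComplexStrongCouplingAnchor)
    (hE : HarmonicMeasureEngine) (hC : ContinuumLegGivenGap) : YangMills := by
  intro G _ _ _ _ hG
  letI : MeasurableSpace G := borel G
  haveI : BorelSpace G := ⟨rfl⟩
  exact hC G hG fun r => hE hA hT hF G hG r

end Summit.QuantumFields.YangMills.Theses.ComplexCouplingChannel
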